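import Summits.ABC.IUTFork.Thm311MultiradProofs
import Summits.ABC.IUTFork.Thm311SigProofs

/-!
# [IUTchIII] Theorem 3.11 (i): log-volume invariance under (Ind1), (Ind2) from PRIMITIVE invariances — proofs

PROOF-ONLY companion (no new definitions, no new signatures) to seat abc-iut-c312-1's record-only files
`Thm311Sig` (A) / `Thm311Multirad` (B) of the abc-iut cell; TAKES NO SIDE. Written by the wave-2 support
seat abc-iut-L6-t13 (plan/WAVE2-SLICES.tsv row 63). Sequel to `Thm311MultiradProofs` (orbit theorem,
`adm_iff_and_logvol_eq_of_mem_closure`) and `Thm311SigProofs` (group structure of (Ind1), (Ind2)).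

What [IUTchIV] Thm. 1.10, Step (v) uses of (Ind1), (Ind2) — typed by abc-iut-c312-1 as the GENERATOR-level
`MRData.LogvolInvariant` (file B) and the GROUP-level `LatticeSituation.LogvolIndInvariant` (file G) —
is, in Dupuy–Hilado's model (arXiv:2004.13228 §4.7, §4.9; the cell's `MultiradialRegion.lnνL_ind1`,
`lnνL_ind2` of abc-iut-c312-3), the conjunction of THREE primitive facts: (P) permuting the tensor factors
preserves the normalised log-volume, (S) the automorphisms induced by isomorphisms of `D⊢`-prime-strips
preserve it, (I) "Ism"/the sign automorphisms preserve it (each together with admissibility). This file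
proves the reduction in the kernel:

* `logvolInvariant_of_primitive`: (P) ∧ (S) ∧ (I) ⟹ `LogvolInvariant D` and one-directional transport
  of admissibility by every (Ind1)- or (Ind2)-family — because an (Ind1)-family acts at `(j, v_ℚ)` as
  `permute σ` FOLLOWED BY a factorwise-summandwise strip automorphism (file A's definition of `Ind1`).
* `adm_iff_of_adm_imp`: if the generating families are closed under inverse ((HS'), (HI') of
  `Thm311SigProofs`), one-directional transport of admissibility is two-directional.
* `adm_and_logvol_eq_of_mem_closure_of_primitive`: hence, under (HS'), (HI'), (P), (S), (I), EVERY element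
  of the generated group `⟨Ind1Family ∪ Ind2Family⟩` (file G's `IndGroup`) carries admissible regions
  to admissible regions of the same log-volume — the body of G's `LogvolIndInvariant`.

Sources read on the page: [IUTchIII] kurims pp. 153–155 (Thm. 3.11 (i)); [IUTchIV] kurims p. 29
(proof of Thm. 1.10, Step (v), l. 62–64: "the indeterminacies (Ind1) and (Ind2) are taken into account
by the arbitrary nature of the automorphism "φ" [cf. Proposition 1.2]"). [claim: Mochizuki2012, status: disputed] for the quoted statements;
[cite: DupuyHilado2025, §4.7, §4.9]; every theorem below is [folklore].
Deliberately NOT here: the primitive facts themselves for the real log-shells (campaign M / the real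
instances of abc-iut-c312-5; Dupuy–Hilado level: abc-iut-c312-3); any definition; any judgement.
-/

namespace Summit.ABC

namespace IUTFork

namespace Thm311

variable {T : ThetaIndex} {L : LogShells T}

namespace MRData

/-- Image of a region under an (Ind1)-move at `(j, v_ℚ)`: first the permutation of the tensor factors,
then the factorwise-summandwise strip automorphism (file A: `Φ v_ℚ = (permute σ).trans (factorwise …)`).
[folklore] -/
theorem image_permute_trans_factorwise (j : T.Label) (vQ : T.VQ) (σ : Equiv.Perm (T.Caps j))
    (e : T.Caps j → (L.Packet1 vQ ≃ₗ[ℚ] L.Packet1 vQ)) (A : Set (L.Packet j vQ)) :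
    ((L.permute j vQ σ).trans (L.factorwise j vQ e) : L.Packet j vQ → L.Packet j vQ) '' A =
      (L.factorwise j vQ e : _ → _) '' ((L.permute j vQ σ : _ → _) '' A) := by
  rw [Set.image_image]; rfl

/-- **Generator-level invariance from primitive invariances.** If at every `(j, v_ℚ)` (P) every
permutation of the tensor factors, (S) every factorwise-summandwise automorphism with components in
`stripAut`, and (I) every factorwise-summandwise automorphism with components in `ism` carries
`D`-admissible regions to `D`-admissible regions of the same log-volume, then `D.LogvolInvariant` (file B:
invariance under every single (Ind1)- or (Ind2)-family) holds, together with one-directional transport of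
admissibility by every such family. [folklore] -/
theorem logvolInvariant_of_primitive (D : MRData L)
    (hP : ∀ (j : T.Label) (vQ : T.VQ) (σ : Equiv.Perm (T.Caps j)) (A : Set (L.Packet j vQ)),
      D.Adm j vQ A → D.Adm j vQ ((L.permute j vQ σ : _ → _) '' A) ∧
        D.logvol j vQ ((L.permute j vQ σ : _ → _) '' A) = D.logvol j vQ A)
    (hS : ∀ (j : T.Label) (vQ : T.VQ) (h : T.Caps j → ∀ v : T.V, L.carrier v ≃ₗ[ℚ] L.carrier v),
      (∀ i v, h i v ∈ L.stripAut v) → ∀ A : Set (L.Packet j vQ), D.Adm j vQ A →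
        D.Adm j vQ ((L.factorwise j vQ fun i => L.summandwise vQ fun v => h i v.1 : _ → _) '' A) ∧
        D.logvol j vQ ((L.factorwise j vQ fun i => L.summandwise vQ fun v => h i v.1 : _ → _) '' A) =
          D.logvol j vQ A)
    (hI : ∀ (j : T.Label) (vQ : T.VQ) (g : T.Caps j → ∀ v : T.Fibre vQ, L.carrier v.1 ≃ₗ[ℚ] L.carrier v.1),
      (∀ i v, g i v ∈ L.ism v.1) → ∀ A : Set (L.Packet j vQ), D.Adm j vQ A →
        D.Adm j vQ ((L.factorwise j vQ fun i => L.summandwise vQ (g i) : _ → _) '' A) ∧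
        D.logvol j vQ ((L.factorwise j vQ fun i => L.summandwise vQ (g i) : _ → _) '' A) = D.logvol j vQ A) :
    D.LogvolInvariant ∧
      ∀ Φ ∈ L.Ind1Family ∪ L.Ind2Family, ∀ (j : T.Label) (vQ : T.VQ) (A : Set (L.Packet j vQ)),
        D.Adm j vQ A → D.Adm j vQ (Φ j vQ '' A) := by
  -- one computation serves both conjuncts
  have key : ∀ Φ ∈ L.Ind1Family ∪ L.Ind2Family, ∀ (j : T.Label) (vQ : T.VQ) (A : Set (L.Packet j vQ)),
      D.Adm j vQ A → D.Adm j vQ (Φ j vQ '' A) ∧ D.logvol j vQ (Φ j vQ '' A) = D.logvol j vQ A := by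
    rintro Φ (hΦ | hΦ) j vQ A hA
    · obtain ⟨σ, h, hh, hΦj⟩ := hΦ j
      have e : Φ j vQ = (L.permute j vQ σ).trans (L.factorwise j vQ fun i => L.summandwise vQ fun v => h i v.1) :=
        hΦj vQ
      rw [e, image_permute_trans_factorwise]
      obtain ⟨hA1, hv1⟩ := hP j vQ σ A hA
      obtain ⟨hA2, hv2⟩ := hS j vQ h hh _ hA1
      exact ⟨hA2, hv2.trans hv1⟩
    · obtain ⟨g, hg, hΦj⟩ := hΦ j vQ
      rw [hΦj]
      exact hI j vQ g hg A hA
  refine ⟨?_, fun Φ hΦ j vQ A hA => (key Φ hΦ j vQ A hA).1⟩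
  intro Φ hΦ j vQ A hA
  exact (key Φ ((Set.mem_union _ _ _).2 hΦ) j vQ A hA).2

/-- If the generating families are closed under inverse — (HS') `stripAut v` and (HI') `ism v` closed
under inverse suffice, by `Thm311SigProofs` — then ONE-directional transport of admissibility by the
generating families is TWO-directional. [folklore] -/
theorem adm_iff_of_adm_imp (D : MRData L)
    (hS' : ∀ v, ∀ a ∈ L.stripAut v, a⁻¹ ∈ L.stripAut v) (hI' : ∀ v, ∀ a ∈ L.ism v, a⁻¹ ∈ L.ism v)
    (hAdm : ∀ Φ ∈ L.Ind1Family ∪ L.Ind2Family, ∀ (j : T.Label) (vQ : T.VQ) (A : Set (L.Packet j vQ)),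
      D.Adm j vQ A → D.Adm j vQ (Φ j vQ '' A)) :
    ∀ Φ ∈ L.Ind1Family ∪ L.Ind2Family, ∀ (j : T.Label) (vQ : T.VQ) (A : Set (L.Packet j vQ)),
      D.Adm j vQ A ↔ D.Adm j vQ (Φ j vQ '' A) := by
  intro Φ hΦ j vQ A
  refine ⟨hAdm Φ hΦ j vQ A, fun h => ?_⟩
  have hΦ' : Φ⁻¹ ∈ L.Ind1Family ∪ L.Ind2Family := by
    rcases hΦ with hΦ | hΦ
    · exact Or.inl (LogShells.inv_mem_Ind1Family hS' hΦ)
    · exact Or.inr (LogShells.inv_mem_Ind2Family hI' hΦ)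
  have h2 := hAdm Φ⁻¹ hΦ' j vQ _ h
  have hback : (Φ⁻¹ j vQ : L.Packet j vQ → L.Packet j vQ) '' ((Φ j vQ : _ → _) '' A) = A := by
    change ((Φ j vQ).symm : _ → _) '' ((Φ j vQ : _ → _) '' A) = A
    rw [Set.image_image]; simp
  rwa [hback] at h2

/-- **Whole-group invariance from primitive invariances.** Under (HS'), (HI') and the three primitive
invariances (P), (S), (I) of `logvolInvariant_of_primitive`, every element of the subgroup generated by
the (Ind1)- and (Ind2)-families (file G's `IndGroup`) carries `D`-admissible regions to `D`-admissible
regions OF THE SAME LOG-VOLUME — the body of file G's `LatticeSituation.LogvolIndInvariant` at `D`.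
This is the form in which "the indeterminacies (Ind1) and (Ind2) are taken into account by the
arbitrary nature of the automorphism "φ"" ([IUTchIV] proof of Thm. 1.10, Step (v), kurims p. 29) is
consumed downstream. [folklore] -/
theorem adm_and_logvol_eq_of_mem_closure_of_primitive (D : MRData L)
    (hS' : ∀ v, ∀ a ∈ L.stripAut v, a⁻¹ ∈ L.stripAut v) (hI' : ∀ v, ∀ a ∈ L.ism v, a⁻¹ ∈ L.ism v)
    (hP : ∀ (j : T.Label) (vQ : T.VQ) (σ : Equiv.Perm (T.Caps j)) (A : Set (L.Packet j vQ)),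
      D.Adm j vQ A → D.Adm j vQ ((L.permute j vQ σ : _ → _) '' A) ∧
        D.logvol j vQ ((L.permute j vQ σ : _ → _) '' A) = D.logvol j vQ A)
    (hS : ∀ (j : T.Label) (vQ : T.VQ) (h : T.Caps j → ∀ v : T.V, L.carrier v ≃ₗ[ℚ] L.carrier v),
      (∀ i v, h i v ∈ L.stripAut v) → ∀ A : Set (L.Packet j vQ), D.Adm j vQ A →
        D.Adm j vQ ((L.factorwise j vQ fun i => L.summandwise vQ fun v => h i v.1 : _ → _) '' A) ∧
        D.logvol j vQ ((L.factorwise j vQ fun i => L.summandwise vQ fun v => h i v.1 : _ → _) '' A) =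
          D.logvol j vQ A)
    (hI : ∀ (j : T.Label) (vQ : T.VQ) (g : T.Caps j → ∀ v : T.Fibre vQ, L.carrier v.1 ≃ₗ[ℚ] L.carrier v.1),
      (∀ i v, g i v ∈ L.ism v.1) → ∀ A : Set (L.Packet j vQ), D.Adm j vQ A →
        D.Adm j vQ ((L.factorwise j vQ fun i => L.summandwise vQ (g i) : _ → _) '' A) ∧
        D.logvol j vQ ((L.factorwise j vQ fun i => L.summandwise vQ (g i) : _ → _) '' A) = D.logvol j vQ A)
    {Φ : L.PacketAut} (hΦ : Φ ∈ Subgroup.closure (L.Ind1Family ∪ L.Ind2Family))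
    (j : T.Label) (vQ : T.VQ) (A : Set (L.Packet j vQ)) (hA : D.Adm j vQ A) :
    D.Adm j vQ (Φ j vQ '' A) ∧ D.logvol j vQ (Φ j vQ '' A) = D.logvol j vQ A :=
  have h := D.logvolInvariant_of_primitive hP hS hI
  D.adm_and_logvol_eq_of_mem_closure (D.adm_iff_of_adm_imp hS' hI' h.2) h.1 hΦ j vQ A hA

end MRData

end Thm311

end IUTFork

end Summit.ABC
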